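import Summits.RiemannHypothesis.RiemannHypothesis.Theorems.PfPersistenceEdgeLawCutLayerCake

/-!
# Edge law by cutting — packaging of the four far correlation terms (RH-free)

Part of the pub-rhpf THEORY-2 programme (mechanism / rigidity of the Weil window bottom; no RH
claims). After `cut_arch_le`, the far singular zone of the steep-cut archimedean commutator
contributes four Lebesgue integrals `∫⁻ Aᵢ Ψᵢ`. Here they are paired and bounded:
* `cut_far_shallow_le`: the two SHALLOW pairs (`A₁, A₃ = ‖u‖²` on the one-sided layers
  `(a−H, a)`, `(−a, −a+H)`, constant profile `β`) sum to `≤ β · m(H)`,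
  `m(H) = ∫_{a−H<|x|} ‖u‖²` (disjointness of the two layers for `H ≤ a`);
* `cut_far_deep_le`: the two DEEP pairs (`A₂, A₄ = ‖u‖² √L_{dep}` on the one-sided far zones,
  profile `κ/(4 · dep · N)`) equal `κ/(2N) · ∫⁻_{far zones} ‖u‖² g(dep)` with the far weight
  `g = cutFarWeight`, and the layer-cake bound `lintegral_cutFarWeight_le` applies.

Sources: folklore measure theory; E. Bombieri, *Remarks on Weil's quadratic functional in the
theory of prime numbers I*, Rend. Mat. Acc. Lincei (9) 11 (2000) §4 (the archimedean form).
-/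

set_option linter.dupNamespace false

noncomputable section

open MeasureTheory Set Filter
open scoped Topology ENNReal NNReal

namespace Summit.RiemannHypothesis.RiemannHypothesis.Theorems.PfPersistence

open Summit.RiemannHypothesis.RiemannHypothesis.Theorems.WeilWindowFlowWindowLipschitz

/-- **The two shallow far pairs.** For `0 ≤ H ≤ a`, `β ≥ 0`:
`∫⁻ 1_{(a−H,a)}‖u‖² β + ∫⁻ 1_{(−a,−a+H)}‖u‖² β ≤ β ∫_{a−H<|x|} ‖u‖²`. [folklore] -/
theorem cut_far_shallow_le {u : ℝ → ℂ} {a H β : ℝ}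
    (hu2 : Integrable fun x ↦ ‖u x‖ ^ 2) (hβ : 0 ≤ β) (hHa : H ≤ a) :
    (∫⁻ p, ENNReal.ofReal ((Ioo (a - H) a).indicator (fun y ↦ ‖u y‖ ^ 2) p * β)) +
      (∫⁻ x, ENNReal.ofReal ((Ioo (-a) (-a + H)).indicator (fun y ↦ ‖u y‖ ^ 2) x * β)) ≤
      ENNReal.ofReal (β * ∫ x in {x : ℝ | a - H < |x|}, ‖u x‖ ^ 2) := by
  set G : ℝ → ℝ≥0∞ := fun x ↦ ENNReal.ofReal (‖u x‖ ^ 2 * β) with hG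
  have hind : ∀ (I : Set ℝ) (x : ℝ),
      ENNReal.ofReal (I.indicator (fun y ↦ ‖u y‖ ^ 2) x * β) = I.indicator G x := by
    intro I x
    by_cases hx : x ∈ I
    · rw [indicator_of_mem hx, indicator_of_mem hx]
    · rw [indicator_of_notMem hx, indicator_of_notMem hx, zero_mul, ENNReal.ofReal_zero]
  simp_rw [hind]
  rw [lintegral_indicator measurableSet_Ioo, lintegral_indicator measurableSet_Ioo]
  have hdisj : Disjoint (Ioo (a - H) a) (Ioo (-a) (-a + H)) :=
    Set.disjoint_left.2 fun x hx1 hx2 ↦ by linarith [hx1.1, hx2.2]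
  rw [← lintegral_union measurableSet_Ioo hdisj]
  have hsub : Ioo (a - H) a ∪ Ioo (-a) (-a + H) ⊆ {x : ℝ | a - H < |x|} := by
    intro x hx
    rcases hx with hx | hx
    · exact hx.1.trans_le (le_abs_self x)
    · have : a - H < -x := by linarith [hx.2]
      exact this.trans_le (neg_le_abs x)
  calc ∫⁻ x in Ioo (a - H) a ∪ Ioo (-a) (-a + H), G x
      ≤ ∫⁻ x in {x : ℝ | a - H < |x|}, G x := lintegral_mono_set hsub
    _ = ENNReal.ofReal (∫ x in {x : ℝ | a - H < |x|}, ‖u x‖ ^ 2 * β) := by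
        rw [hG, ← ofReal_integral_eq_lintegral_ofReal (hu2.integrableOn.mul_const β)
          (Eventually.of_forall fun x ↦ mul_nonneg (sq_nonneg _) hβ)]
    _ = ENNReal.ofReal (β * ∫ x in {x : ℝ | a - H < |x|}, ‖u x‖ ^ 2) := by
        rw [integral_mul_const, mul_comm]

/-- **The two deep far pairs.** With `I₁ = [a−r₀, a−R]`, `I₂ = [−a+R, −a+r₀]` (`2r₀ ≤ a`),
`κ ≥ 0`, `N > 0` and the cumulative edge-mass bound `∫_{a−r<|x|} ‖u‖² ≤ I′r/log(1/r)` on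
`(0, r₀]`:
`∫⁻ 1_{I₁}(x)‖u x‖²√L_{a−x} κ/(4(a−x)N) + ∫⁻ 1_{I₂}(p)‖u p‖²√L_{a+p} κ/(4(a+p)N)`
`≤ κ/(2N) · (g(r₀)∫‖u‖² + I′((√L_R − √L_{r₀}) + (1/(2√L_{r₀}) − 1/(2√L_R))))`. [folklore] -/
theorem cut_far_deep_le {u : ℝ → ℂ} {a R r₀ I' κ N : ℝ} (hum : Measurable u)
    (hu2 : Integrable fun x ↦ ‖u x‖ ^ 2) (hR : 0 < R) (hRr : R ≤ r₀) (hr1 : r₀ < 1) (hI : 0 ≤ I')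
    (hB : ∀ r, 0 < r → r ≤ r₀ →
      ∫ x in {x : ℝ | a - r < |x|}, ‖u x‖ ^ 2 ≤ I' * r / Real.log (1 / r))
    (hra : 2 * r₀ ≤ a) (hκ : 0 ≤ κ) (hN : 0 < N) :
    (∫⁻ x, ENNReal.ofReal ((Icc (a - r₀) (a - R)).indicator
        (fun y ↦ ‖u y‖ ^ 2 * Real.sqrt (Real.log (1 / (a - y)))) x * (κ / (4 * (a - x) * N)))) +
      (∫⁻ p, ENNReal.ofReal ((Icc (-a + R) (-a + r₀)).indicator
        (fun y ↦ ‖u y‖ ^ 2 * Real.sqrt (Real.log (1 / (a + y)))) p * (κ / (4 * (a + p) * N)))) ≤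
      ENNReal.ofReal (κ / (2 * N) * (cutFarWeight r₀ * (∫ x, ‖u x‖ ^ 2) +
        I' * ((Real.sqrt (Real.log (1 / R)) - Real.sqrt (Real.log (1 / r₀))) +
          (1 / (2 * Real.sqrt (Real.log (1 / r₀))) - 1 / (2 * Real.sqrt (Real.log (1 / R))))))) := by
  set G : ℝ → ℝ≥0∞ := fun x ↦ ENNReal.ofReal (‖u x‖ ^ 2 * cutFarWeight (a - |x|)) with hG
  set I₁ : Set ℝ := Icc (a - r₀) (a - R) with hI₁
  set I₂ : Set ℝ := Icc (-a + R) (-a + r₀) with hI₂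
  have hr0 : 0 < r₀ := hR.trans_le hRr
  have h1 : ∀ x, ENNReal.ofReal (I₁.indicator
      (fun y ↦ ‖u y‖ ^ 2 * Real.sqrt (Real.log (1 / (a - y)))) x * (κ / (4 * (a - x) * N))) =
      ENNReal.ofReal (κ / (2 * N)) * I₁.indicator G x := by
    intro x
    by_cases hx : x ∈ I₁
    · rw [indicator_of_mem hx, indicator_of_mem hx, hG]
      have hx0 : 0 < x := by linarith [hx.1]
      have hax : 0 < a - x := by linarith [hx.2]
      rw [← ENNReal.ofReal_mul (by positivity), abs_of_pos hx0, cutFarWeight]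
      congr 1
      field_simp
      ring
    · rw [indicator_of_notMem hx, indicator_of_notMem hx, zero_mul, mul_zero, ENNReal.ofReal_zero]
  have h2 : ∀ p, ENNReal.ofReal (I₂.indicator
      (fun y ↦ ‖u y‖ ^ 2 * Real.sqrt (Real.log (1 / (a + y)))) p * (κ / (4 * (a + p) * N))) =
      ENNReal.ofReal (κ / (2 * N)) * I₂.indicator G p := by
    intro p
    by_cases hp : p ∈ I₂
    · rw [indicator_of_mem hp, indicator_of_mem hp, hG]
      have hp0 : p < 0 := by linarith [hp.2]
      have hap : 0 < a + p := by linarith [hp.1]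
      rw [← ENNReal.ofReal_mul (by positivity), abs_of_neg hp0, sub_neg_eq_add, cutFarWeight]
      congr 1
      field_simp
      ring
    · rw [indicator_of_notMem hp, indicator_of_notMem hp, zero_mul, mul_zero, ENNReal.ofReal_zero]
  simp_rw [h1, h2]
  rw [lintegral_const_mul' _ _ ENNReal.ofReal_ne_top, lintegral_const_mul' _ _ ENNReal.ofReal_ne_top,
    ← mul_add, lintegral_indicator measurableSet_Icc, lintegral_indicator measurableSet_Icc]
  have hdisj : Disjoint I₁ I₂ :=
    Set.disjoint_left.2 fun x hx1 hx2 ↦ by linarith [hx1.1, hx2.2]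
  rw [← lintegral_union measurableSet_Icc hdisj]
  have hsub : I₁ ∪ I₂ ⊆ {x : ℝ | R ≤ a - |x| ∧ a - |x| ≤ r₀} := by
    intro x hx
    rcases hx with hx | hx
    · have hx0 : 0 < x := by linarith [hx.1]
      rw [mem_setOf_eq, abs_of_pos hx0]
      exact ⟨by linarith [hx.2], by linarith [hx.1]⟩
    · have hx0 : x < 0 := by linarith [hx.2]
      rw [mem_setOf_eq, abs_of_neg hx0]
      exact ⟨by linarith [hx.1], by linarith [hx.2]⟩
  calc ENNReal.ofReal (κ / (2 * N)) * ∫⁻ x in I₁ ∪ I₂, G x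
      ≤ ENNReal.ofReal (κ / (2 * N)) * ∫⁻ x in {x : ℝ | R ≤ a - |x| ∧ a - |x| ≤ r₀}, G x :=
        mul_le_mul_of_nonneg_left (lintegral_mono_set hsub) zero_le
    _ ≤ ENNReal.ofReal (κ / (2 * N)) * ENNReal.ofReal (cutFarWeight r₀ * (∫ x, ‖u x‖ ^ 2) +
        I' * ((Real.sqrt (Real.log (1 / R)) - Real.sqrt (Real.log (1 / r₀))) +
          (1 / (2 * Real.sqrt (Real.log (1 / r₀))) - 1 / (2 * Real.sqrt (Real.log (1 / R)))))) :=
        mul_le_mul_of_nonneg_left (lintegral_cutFarWeight_le hum hu2 hR hRr hr1 hI hB) zero_le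
    _ = _ := (ENNReal.ofReal_mul (by positivity)).symm

end Summit.RiemannHypothesis.RiemannHypothesis.Theorems.PfPersistence

end
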